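import Literature.Barriers.RiemannHypothesis.TuranMinWitnessCalc
import Literature.Barriers.RiemannHypothesis.TuranMinWitnessIdentity
import HarnessLib

/-!
# Certified evaluation of `T(72 204 113 780 255)`: the sieve and the tables

Barrier catalogue `Literature/Barriers/RiemannHypothesis/`, support file for the discharge of
`Literature.Barriers.RiemannHypothesis.BFM2008_thm1_minWitness`. Specifications of the first layer
of the evaluator `TuranMinWitnessCalc.lean`:

* the segmented sieve for `λ` with the primes `< P = 43000` (the sieve of
  `Literature/NumberTheory/LFunctions/LiouvilleSieve.lean`, whose generic lemmas are reused; only the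
  arithmetic lemmas that mention the sieving bound are redone for `P = 43000`):
  `lamOf_segSieve` — on a segment `[lo, lo + Q)` with `Q ∣ lo`, `lo + Q ≤ P²`, the value read off the
  sieved array IS `λ`;
* `prefixSums_getElem?` (generic prefix sums), `htab_getElem?` / `htab_real` / `htab_mono`
  (`0 ≤ 2^57 H(w) − htab[w] < 2`), `lamBits_getElem?` / `lamOfBit_lamBits` (the bit table is `λ`),
  `tPre_getElem?`, `tSeg_getElem?` and the real-number bounds `abs_tauDiff_le` for prefix sums of
  `λ(k)⌊2^110/k⌋`.

## References

* [BorweinFergusonMossinghoff2008] P. Borwein, R. Ferguson, M. J. Mossinghoff, Math. Comp. 77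
  (2008), 1681–1694, Thm. 1.
-/

open Finset ArithmeticFunction
open Literature.NumberTheory.LFunctions (LiouvilleSum.abs_liouville_le_one)
open Literature.NumberTheory.LFunctions.LiouvilleSieve (rawProd rawProd_one_eq rawProd_add_of_dvd
  rawProd_mul rawProd_self getElem?_sieveFrom size_sieveFrom size_pattern getElem?_pattern
  one_le_startExp startExp_of_ne le_stopExp le_pow_stopExp stopExp startExp segSieve pattern Q lamOf
  size_segSieve)

namespace Literature.Barriers.RiemannHypothesis.TuranMinWitness

-- The executable tables must never be unfolded by definitional reduction inside proofs (a `rfl`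
-- attempt would try to evaluate a sieve of `43000` primes): they are reasoned about only through
-- the equation lemmas below.
attribute [local irreducible] primesList Literature.NumberTheory.LFunctions.LiouvilleSieve.pattern
  Literature.NumberTheory.LFunctions.LiouvilleSieve.segSieve

/-! ## The sieve with `P = 43000` -/

section Sieve

/-- The set of sieving primes `p < P`. [folklore] -/
def PF : Finset ℕ := (Finset.range P).filter Nat.Prime

/-- Membership in `PF`. [folklore] -/
theorem mem_PF {p : ℕ} : p ∈ PF ↔ p < P ∧ p.Prime := by simp [PF]

/-- `primesList` enumerates `PF`. [folklore] -/
theorem primesList_toFinset : primesList.toFinset = PF := by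
  ext p; simp [primesList, PF]

/-- `primesList` has no duplicates. [folklore] -/
theorem nodup_primesList : primesList.Nodup := by
  unfold primesList; exact List.nodup_range.filter _

/-- A product over `primesList` is a product over `PF`. [folklore] -/
theorem prod_primesList (f : ℕ → ℤ) : (primesList.map f).prod = ∏ p ∈ PF, f p := by
  rw [← primesList_toFinset, List.prod_toFinset f nodup_primesList]

/-- The sieve value of `n`: `∏_{p < P prime} (-p)^{v_p(n)}`. [folklore] -/
def sieveVal (n : ℕ) : ℤ := ∏ p ∈ PF, (-(p : ℤ)) ^ n.factorization p

/-- The `P`-smooth part of `n`. [folklore] -/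
def smoothPart (n : ℕ) : ℕ := ∏ p ∈ PF, p ^ n.factorization p

/-- The number of prime factors `p < P` of `n`, with multiplicity. [folklore] -/
def smallOmega (n : ℕ) : ℕ := ∑ p ∈ PF, n.factorization p

/-- `P² < 2³²` (so `32` extra powers of any prime exceed every segment bound). [folklore] -/
theorem P_sq_lt : P ^ 2 < 2 ^ 32 := by decide

/-- The entries of a sieved segment are the sieve values. [folklore] -/
theorem getElem?_segSieve (lo : ℕ) (init : Array ℤ) (hlo : Q ∣ lo) (hH : lo + init.size ≤ P ^ 2)
    (hinit : ∀ j < init.size, init[j]? = (pattern Q)[j]?) (j : ℕ) (hj : j < init.size)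
    (hn : lo + j ≠ 0) :
    (segSieve primesList lo init)[j]? = some (sieveVal (lo + j)) := by
  have hjQ : j < Q := by
    by_contra hge
    have h1 := hinit j hj
    rw [Array.getElem?_eq_getElem hj, Eq.comm, Array.getElem?_eq_none
      (by rw [size_pattern]; exact Nat.le_of_not_lt hge)] at h1
    exact Option.some_ne_none _ h1.symm
  rw [segSieve, getElem?_sieveFrom, hinit j hj, getElem?_pattern Q j hjQ, Option.map_some,
    prod_primesList]
  have hnH : lo + j < lo + init.size := by omega
  have hdvd : ∀ (p s : ℕ), p ^ (s - 1) ∣ Q → ∀ k < s, p ^ k ∣ lo := fun p s hs k hk =>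
    ((pow_dvd_pow p (by omega : k ≤ s - 1)).trans hs).trans hlo
  have hpat : rawProd 2 j 1 6 * rawProd 3 j 1 4 * rawProd 5 j 1 3 * rawProd 7 j 1 3 =
      ∏ p ∈ PF, rawProd p (lo + j) 1 (startExp p) := by
    rw [← rawProd_add_of_dvd (lo := lo) (hdvd 2 6 (by decide)),
      ← rawProd_add_of_dvd (lo := lo) (hdvd 3 4 (by decide)),
      ← rawProd_add_of_dvd (lo := lo) (hdvd 5 3 (by decide)),
      ← rawProd_add_of_dvd (lo := lo) (hdvd 7 3 (by decide))]
    have hsub : ({2, 3, 5, 7} : Finset ℕ) ⊆ PF := by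
      intro p hp
      simp only [Finset.mem_insert, Finset.mem_singleton] at hp
      rw [mem_PF, P]
      rcases hp with rfl | rfl | rfl | rfl <;> norm_num
    rw [← Finset.prod_subset hsub]
    · simp [startExp, mul_assoc]
    · intro p _ hp
      simp only [Finset.mem_insert, Finset.mem_singleton, not_or] at hp
      rw [startExp_of_ne hp.1 hp.2.1 hp.2.2.1 hp.2.2.2, rawProd_self]
  rw [hpat, ← Finset.prod_mul_distrib, sieveVal]
  refine congrArg some (Finset.prod_congr rfl (fun p hp => ?_))
  have hp' := (mem_PF.mp hp).2
  have hle : startExp p ≤ stopExp p (lo + init.size) 32 (startExp p) := le_stopExp _ _ _ _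
  rw [rawProd_mul (one_le_startExp p) hle]
  refine rawProd_one_eq hp' hn (lt_of_lt_of_le hnH (le_pow_stopExp p _ 32 _ hp'.pos ?_))
  calc lo + init.size ≤ P ^ 2 := hH
    _ ≤ 2 ^ 32 := P_sq_lt.le
    _ ≤ 2 ^ (startExp p + 32) := Nat.pow_le_pow_right (by norm_num) (by omega)
    _ ≤ p ^ (startExp p + 32) := Nat.pow_le_pow_left hp'.two_le _

/-- `sieveVal n = (-1)^{smallOmega n} · smoothPart n`. [folklore] -/
theorem sieveVal_eq (n : ℕ) : sieveVal n = (-1) ^ smallOmega n * (smoothPart n : ℤ) := by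
  unfold sieveVal smallOmega smoothPart
  rw [Nat.cast_prod, ← Finset.prod_pow_eq_pow_sum, ← Finset.prod_mul_distrib]
  refine Finset.prod_congr rfl (fun p _ => ?_)
  rw [Nat.cast_pow, ← mul_pow, neg_one_mul]

/-- The smooth part is positive. [folklore] -/
theorem smoothPart_pos (n : ℕ) : 0 < smoothPart n :=
  Finset.prod_pos (fun _ hp => pow_pos (mem_PF.mp hp).2.pos _)

/-- The key arithmetic fact: for `0 < n < P²`, `λ(n) = (-1)^{smallOmega n} · [smoothPart n = n]±`.
[folklore] -/
theorem liouville_eq_of_lt (n : ℕ) (hn : n ≠ 0) (hnP : n < P ^ 2) :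
    (liouville n : ℤ) = (-1) ^ smallOmega n * (if smoothPart n = n then 1 else -1) := by
  classical
  set small := n.primeFactors.filter (· < P) with hsmall
  set big := n.primeFactors.filter (fun p => ¬ p < P) with hbig
  set B := ∏ p ∈ big, p ^ n.factorization p with hB
  set u := ∑ p ∈ big, n.factorization p with hu
  have hprod : ∏ p ∈ n.primeFactors, p ^ n.factorization p = n := by
    have := Nat.prod_factorization_pow_eq_self hn
    rwa [Finsupp.prod, Nat.support_factorization] at this
  have hsmallPF : small ⊆ PF := fun p hp => by
    rw [hsmall, Finset.mem_filter] at hp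
    exact mem_PF.mpr ⟨hp.2, Nat.prime_of_mem_primeFactors hp.1⟩
  have hzero : ∀ p ∈ PF, p ∉ small → n.factorization p = 0 := fun p hp hps => by
    have : p ∉ n.primeFactors := fun h => hps (by
      rw [hsmall, Finset.mem_filter]; exact ⟨h, (mem_PF.mp hp).1⟩)
    exact Finsupp.notMem_support_iff.mp (by rwa [Nat.support_factorization])
  have hA : smoothPart n = ∏ p ∈ small, p ^ n.factorization p := by
    rw [smoothPart, ← Finset.prod_subset hsmallPF (fun p hp hps => by rw [hzero p hp hps, pow_zero])]
  have ht : smallOmega n = ∑ p ∈ small, n.factorization p := by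
    rw [smallOmega, ← Finset.sum_subset hsmallPF (fun p hp hps => hzero p hp hps)]
  have hAB : smoothPart n * B = n := by
    rw [hA, hB, hsmall, hbig, Finset.prod_filter_mul_prod_filter_not, hprod]
  have hOmega : cardFactors n = smallOmega n + u := by
    rw [ArithmeticFunction.cardFactors_eq_sum_factorization, Finsupp.sum, Nat.support_factorization,
      ht, hu, hsmall, hbig, Finset.sum_filter_add_sum_filter_not]
  have hBge : P ^ u ≤ B := by
    rw [hu, hB, ← Finset.prod_pow_eq_pow_sum]
    refine Finset.prod_le_prod (fun p _ => Nat.zero_le _) (fun p hp => ?_)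
    rw [hbig, Finset.mem_filter] at hp
    exact Nat.pow_le_pow_left (Nat.le_of_not_lt hp.2) _
  have hBle : B ≤ n := by
    have := smoothPart_pos n
    nlinarith [hAB]
  have hu1 : u < 2 := by
    have : P ^ u < P ^ 2 := lt_of_le_of_lt (hBge.trans hBle) hnP
    exact (Nat.pow_lt_pow_iff_right (by decide : 1 < P)).mp this
  rw [ArithmeticFunction.liouville_apply hn, hOmega, pow_add]
  suffices hu2 : ((-1 : ℤ) ^ u) = (if smoothPart n = n then 1 else -1) by rw [hu2]
  interval_cases hu' : u
  · have hbig0 : ∀ p ∈ big, n.factorization p = 0 :=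
      (Finset.sum_eq_zero_iff_of_nonneg (fun _ _ => Nat.zero_le _)).mp hu'
    have hB1 : B = 1 := by
      rw [hB]
      exact Finset.prod_eq_one (fun p hp => by rw [hbig0 p hp, pow_zero])
    rw [hB1, mul_one] at hAB
    rw [if_pos hAB, pow_zero]
  · have hAne : smoothPart n ≠ n := by
      intro hAn
      rw [hAn] at hAB
      have hB1 : B = 1 :=
        Nat.eq_of_mul_eq_mul_left (Nat.pos_of_ne_zero hn) (by rw [mul_one]; exact hAB)
      have : P ≤ 1 := by simpa [hB1] using hBge
      exact absurd this (by decide)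
    rw [if_neg hAne, pow_one]

/-- Reading `λ(n)` off the sieve value. [folklore] -/
theorem lamOf_sieveVal (n : ℕ) (hn : n ≠ 0) (hnP : n < P ^ 2) :
    lamOf n (sieveVal n) = liouville n := by
  rw [liouville_eq_of_lt n hn hnP, sieveVal_eq]
  unfold lamOf
  have hA := smoothPart_pos n
  have habs : ((-1 : ℤ) ^ smallOmega n * (smoothPart n : ℤ)).natAbs = smoothPart n := by
    rw [Int.natAbs_mul, Int.natAbs_pow, Int.natAbs_neg, Int.natAbs_one, one_pow, one_mul,
      Int.natAbs_natCast]
  have hsign : ((-1 : ℤ) ^ smallOmega n * (smoothPart n : ℤ)).sign = (-1) ^ smallOmega n := by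
    rw [Int.sign_mul, Int.sign_natCast_of_ne_zero hA.ne', mul_one]
    rcases neg_one_pow_eq_or ℤ (smallOmega n) with h | h
    · rw [h]; rfl
    · rw [h]; rfl
  rw [habs, hsign]
  by_cases hAn : smoothPart n = n
  · rw [if_pos hAn, if_pos hAn, mul_one]
  · rw [if_neg hAn, if_neg hAn, mul_neg_one]

/-- **Correctness of the sieve on a full segment**: for `Q ∣ lo`, `lo + Q ≤ P²`, the value read off
the sieved pattern at index `j < Q` is `λ(lo + j)` (for `lo + j ≠ 0`). [folklore] -/
theorem lamOf_segSieve (lo : ℕ) (hlo : Q ∣ lo) (hH : lo + Q ≤ P ^ 2) (j : ℕ) (hj : j < Q)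
    (hn : lo + j ≠ 0) {v : ℤ} (hv : (segSieve primesList lo (pattern Q))[j]? = some v) :
    lamOf (lo + j) v = liouville (lo + j) := by
  have h := getElem?_segSieve lo (pattern Q) hlo (by rwa [size_pattern]) (fun _ _ => rfl) j
    (by rwa [size_pattern]) hn
  rw [hv, Option.some.injEq] at h
  rw [h]
  exact lamOf_sieveVal _ hn (by omega)

/-- The size of a sieved full segment is `Q`. [folklore] -/
theorem size_segSieve_pattern (lo : ℕ) : (segSieve primesList lo (pattern Q)).size = Q := by
  rw [size_segSieve, size_pattern]

end Sieve

/-! ## Arrays: reading `a[i]!` from `a[i]?` -/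

/-- If `a[i]? = some v` then `a[i]! = v`. [folklore] -/
theorem getElem!_of_getElem? {α : Type} [Inhabited α] {a : Array α} {i : ℕ} {v : α}
    (h : a[i]? = some v) : a[i]! = v := by
  have hi : i < a.size := by
    by_contra hle
    rw [Array.getElem?_eq_none (Nat.le_of_not_lt hle)] at h
    exact absurd h (by simp)
  rw [getElem!_pos a i hi]
  rw [Array.getElem?_eq_getElem hi, Option.some.injEq] at h
  exact h

/-! ## Generic prefix sums -/

section Prefix

variable {α : Type} [AddCommMonoid α]

/-- The partial sums `S(i) = ∑_{0 < j ≤ i} g j`. [folklore] -/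
def psum (g : ℕ → α) (i : ℕ) : α := ∑ j ∈ Ioc 0 i, g j

omit [AddCommMonoid α] in
/-- Invariant of `prefixSumsAux`. [folklore] -/
theorem prefixSumsAux_spec [AddCommMonoid α] (g : ℕ → α) :
    ∀ (fuel m : ℕ) (acc : α) (a : Array α), 1 ≤ m → a.size = m → acc = psum g (m - 1) →
      (∀ i < m, a[i]? = some (psum g i)) →
      (prefixSumsAux g fuel m acc a).size = m + fuel ∧
        ∀ i < m + fuel, (prefixSumsAux g fuel m acc a)[i]? = some (psum g i)
  | 0, m, acc, a, _, hsz, _, hget => by simpa [prefixSumsAux, hsz] using hget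
  | fuel + 1, m, acc, a, hm, hsz, hacc, hget => by
    simp only [prefixSumsAux]
    have hacc' : acc + g m = psum g (m + 1 - 1) := by
      rw [hacc, Nat.add_sub_cancel, psum, psum]
      obtain ⟨m', rfl⟩ : ∃ m', m = m' + 1 := ⟨m - 1, by omega⟩
      rw [Nat.add_sub_cancel, sum_Ioc_succ_top (Nat.zero_le m')]
    have h := prefixSumsAux_spec g fuel (m + 1) (acc + g m) (a.push (acc + g m)) (by omega)
      (by rw [Array.size_push, hsz]) hacc' (fun i hi => by
        rw [Array.getElem?_push]
        split_ifs with h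
        · rw [h, hsz, hacc', Nat.add_sub_cancel]
        · exact hget i (by rw [hsz] at h; omega))
    rw [show m + (fuel + 1) = m + 1 + fuel by ring]
    exact h

omit [AddCommMonoid α] in
/-- `prefixSums g n` has size `n + 1`. [folklore] -/
theorem size_prefixSums [AddCommMonoid α] (g : ℕ → α) (n : ℕ) : (prefixSums g n).size = n + 1 := by
  have h := prefixSumsAux_spec g n 1 0 ((Array.mkEmpty (n + 1)).push 0) le_rfl (by simp)
    (by simp [psum]) (fun i hi => by
      interval_cases i
      simp [psum])
  rw [prefixSums, h.1, add_comm]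

omit [AddCommMonoid α] in
/-- The entries of `prefixSums g n` are the partial sums `∑_{0<j≤i} g j`, `i ≤ n`. [folklore] -/
theorem prefixSums_getElem? [AddCommMonoid α] (g : ℕ → α) (n : ℕ) {i : ℕ} (hi : i ≤ n) :
    (prefixSums g n)[i]? = some (∑ j ∈ Ioc 0 i, g j) := by
  have h := prefixSumsAux_spec g n 1 0 ((Array.mkEmpty (n + 1)).push 0) le_rfl (by simp)
    (by simp [psum]) (fun i hi => by
      interval_cases i
      simp [psum])
  rw [prefixSums]
  exact h.2 i (by omega)

end Prefix

/-! ## The harmonic table `htab` -/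

/-- `A(w) = ∑_{m ≤ w} ⌊2^90/m⌋`. [folklore] -/
def hSum (w : ℕ) : ℕ := ∑ m ∈ Ioc 0 w, 2 ^ (SH + SI) / m

/-- `A` is monotone. [folklore] -/
theorem hSum_mono {v w : ℕ} (h : v ≤ w) : hSum v ≤ hSum w := by
  unfold hSum
  exact sum_le_sum_of_subset (Ioc_subset_Ioc_right h)

/-- Size of `htab`. [folklore] -/
theorem size_htab (W : ℕ) : (htab W).size = W + 1 := by
  rw [htab, Array.size_map, size_prefixSums]

/-- The entries of `htab`: `htab[w] = A(w) >>> 33`. [folklore] -/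
theorem htab_getElem? (W : ℕ) {w : ℕ} (hw : w ≤ W) : (htab W)[w]? = some (hSum w / 2 ^ SI) := by
  rw [htab, Array.getElem?_map, prefixSums_getElem? _ _ hw, Option.map_some, Nat.shiftRight_eq_div_pow]
  rfl

/-- `htab` is monotone. [folklore] -/
theorem htab_mono (W : ℕ) {v w : ℕ} (hvw : v ≤ w) (hw : w ≤ W) : (htab W)[v]! ≤ (htab W)[w]! := by
  rw [getElem!_of_getElem? (htab_getElem? W (hvw.trans hw)), getElem!_of_getElem? (htab_getElem? W hw)]
  exact Nat.div_le_div_right (hSum_mono hvw)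

/-- `A(w) ≤ 2^90 H(w) ≤ A(w) + w`. [folklore] -/
theorem hSum_real (w : ℕ) :
    (hSum w : ℝ) ≤ 2 ^ (SH + SI) * Hn w ∧ 2 ^ (SH + SI) * Hn w ≤ hSum w + w := by
  induction w with
  | zero => simp [hSum, Hn]
  | succ n ih =>
    have hs : hSum (n + 1) = hSum n + 2 ^ (SH + SI) / (n + 1) := by
      rw [hSum, hSum, sum_Ioc_succ_top (Nat.zero_le n)]
    set q : ℕ := 2 ^ (SH + SI) / (n + 1) with hq
    have hq1 : (q : ℝ) * (n + 1 : ℕ) ≤ 2 ^ (SH + SI) := by exact_mod_cast Nat.div_mul_le_self _ _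
    have hq2 : (2 : ℝ) ^ (SH + SI) < q * (n + 1 : ℕ) + (n + 1 : ℕ) := by
      exact_mod_cast Nat.lt_div_mul_add (Nat.succ_pos n)
    have hpos : (0 : ℝ) < (n + 1 : ℕ) := by positivity
    have hA : (q : ℝ) ≤ 2 ^ (SH + SI) * (1 / ((n + 1 : ℕ) : ℝ)) := by
      rw [mul_one_div, le_div_iff₀ hpos]; exact hq1
    have hB : (2 : ℝ) ^ (SH + SI) * (1 / ((n + 1 : ℕ) : ℝ)) ≤ q + 1 := by
      rw [mul_one_div, div_le_iff₀ hpos]; linarith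
    have hn1 : ((n + 1 : ℕ) : ℝ) = (n : ℝ) + 1 := by push_cast; ring
    rw [hs, Hn_succ, Nat.cast_add, mul_add]
    constructor <;> linarith [ih.1, ih.2]

/-- **The harmonic table is `2^57 H` within two units**: for `w ≤ W < 2^33`,
`htab[w] ≤ 2^57 H(w) < htab[w] + 2`. [folklore] -/
theorem htab_real (W : ℕ) (hW : W < 2 ^ 33) {w : ℕ} (hw : w ≤ W) :
    ((htab W)[w]! : ℝ) ≤ 2 ^ SH * Hn w ∧ 2 ^ SH * Hn w < (htab W)[w]! + 2 := by
  rw [getElem!_of_getElem? (htab_getElem? W hw)]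
  obtain ⟨h1, h2⟩ := hSum_real w
  have hSI : (2 : ℝ) ^ (SH + SI) = 2 ^ SH * 2 ^ SI := by rw [pow_add]
  have hpos : (0 : ℝ) < 2 ^ SI := by positivity
  set A := hSum w with hA
  have hdiv : ((A / 2 ^ SI : ℕ) : ℝ) ≤ (A : ℝ) / 2 ^ SI := by
    have := Nat.cast_div_le (m := A) (n := 2 ^ SI) (α := ℝ)
    push_cast at this
    exact this
  have hdiv2 : (A : ℝ) < ((A / 2 ^ SI : ℕ) : ℝ) * 2 ^ SI + 2 ^ SI := by
    have := Nat.lt_div_mul_add (a := A) (b := 2 ^ SI) (by positivity)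
    exact_mod_cast this
  have hw' : (w : ℝ) < 2 ^ SI := by
    rw [SI]
    have : (w : ℝ) ≤ W := by exact_mod_cast hw
    have : (W : ℝ) < 2 ^ 33 := by exact_mod_cast hW
    linarith
  constructor
  · rw [hSI] at h1
    calc ((A / 2 ^ SI : ℕ) : ℝ) ≤ A / 2 ^ SI := hdiv
      _ ≤ 2 ^ SH * 2 ^ SI * Hn w / 2 ^ SI := by gcongr
      _ = 2 ^ SH * Hn w := by field_simp
  · rw [hSI] at h2
    have : 2 ^ SH * Hn w * 2 ^ SI < (((A / 2 ^ SI : ℕ) : ℝ) + 2) * 2 ^ SI := by nlinarith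
    exact lt_of_mul_lt_mul_right this hpos.le

/-! ## The bit table of `λ` -/

/-- Entries of `segments`. [folklore] -/
theorem segments_getElem? (pat : Array ℤ) (W : ℕ) {s : ℕ} (hs : s < W / Q + 1) :
    (segments pat W)[s]? = some (segSieve primesList (s * Q) pat) := by
  rw [segments, Array.getElem?_map, Array.getElem?_range, if_pos hs, Option.map_some]

/-- **The bit table is `λ`**: for `1 ≤ k ≤ W` with `W + Q ≤ P²`,
`(lamBits (pattern Q) W)[k]? = some [λ(k) = 1]`. [folklore] -/
theorem lamBits_getElem? {W : ℕ} (hWP : W + Q ≤ P ^ 2) {k : ℕ} (hk1 : 1 ≤ k) (hkW : k ≤ W) :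
    (lamBits (pattern Q) W)[k]? = some (decide (liouville k = 1)) := by
  have hQ : 0 < Q := by decide
  have hk : k < W + 1 := Nat.lt_succ_of_le hkW
  rw [lamBits, Array.getElem?_ofFn]
  simp only [hk, dite_true]
  congr 1
  have hs : k / Q < W / Q + 1 := Nat.lt_succ_of_le (Nat.div_le_div_right hkW)
  rw [getElem!_of_getElem? (segments_getElem? (pattern Q) W hs)]
  have hj : k % Q < Q := Nat.mod_lt _ hQ
  have hsz : k % Q < (segSieve primesList (k / Q * Q) (pattern Q)).size := by
    rwa [size_segSieve_pattern]
  rw [getElem!_pos (segSieve primesList (k / Q * Q) (pattern Q)) (k % Q) hsz]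
  have hv := Array.getElem?_eq_getElem hsz
  have hkey := lamOf_segSieve (k / Q * Q) (Dvd.intro_left _ rfl)
    (by
      have : k / Q * Q ≤ W / Q * Q := Nat.mul_le_mul_right Q (Nat.div_le_div_right hkW)
      have : W / Q * Q ≤ W := Nat.div_mul_le_self W Q
      omega)
    (k % Q) hj (by rw [Nat.div_add_mod']; omega) hv
  rw [Nat.div_add_mod'] at hkey
  rw [hkey]

/-- `λ(k)` read off the bit table, `1 ≤ k ≤ W`. [folklore] -/
theorem lamOfBit_lamBits {W : ℕ} (hWP : W + Q ≤ P ^ 2) {k : ℕ} (hk1 : 1 ≤ k) (hkW : k ≤ W) :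
    lamOfBit (lamBits (pattern Q) W) k = liouville k := by
  unfold lamOfBit
  rw [getElem!_of_getElem? (lamBits_getElem? hWP hk1 hkW)]
  have hk0 : k ≠ 0 := by omega
  rw [ArithmeticFunction.liouville_apply hk0]
  rcases neg_one_pow_eq_or ℤ (cardFactors k) with h | h <;> rw [h] <;> simp

/-! ## Prefix tables of `λ(k)⌊2^110/k⌋` -/

/-- `τ(k) = ∑_{j ≤ k} λ(j) ⌊2^110/j⌋`, the exact integer behind `tPre` and `tSeg`. [folklore] -/
def tau (k : ℕ) : ℤ := ∑ j ∈ Ioc 0 k, (liouville j : ℤ) * ((2 ^ ST / j : ℕ) : ℤ)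

/-- `τ(b) − τ(a) = ∑_{a < j ≤ b} λ(j)⌊2^110/j⌋`. [folklore] -/
theorem tau_sub_tau {a b : ℕ} (h : a ≤ b) :
    tau b - tau a = ∑ j ∈ Ioc a b, (liouville j : ℤ) * ((2 ^ ST / j : ℕ) : ℤ) := by
  unfold tau; rw [← sum_Ioc_consecutive _ (Nat.zero_le a) h]; ring

/-- **The prefix sums are `2^110 T` up to the number of terms**:
`|(τ(b) − τ(a)) − 2^110 (T(b) − T(a))| ≤ b − a` for `a ≤ b`. [folklore] -/
theorem abs_tauDiff_le {a b : ℕ} (h : a ≤ b) :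
    |((tau b - tau a : ℤ) : ℝ) - 2 ^ ST * (Tn b - Tn a)| ≤ (b - a : ℕ) := by
  rw [tau_sub_tau h, Tn_sub_Tn h, Int.cast_sum, mul_sum, ← sum_sub_distrib]
  have hcard : ((b - a : ℕ) : ℝ) = ∑ j ∈ Ioc a b, (1 : ℝ) := by simp
  rw [hcard]
  refine (abs_sum_le_sum_abs _ _).trans (sum_le_sum fun j hj => ?_)
  have hj0 : 0 < j := lt_of_le_of_lt (Nat.zero_le a) (mem_Ioc.1 hj).1
  set q : ℕ := 2 ^ ST / j with hq
  have hq1 : (q : ℝ) * j ≤ 2 ^ ST := by exact_mod_cast Nat.div_mul_le_self _ _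
  have hq2 : (2 : ℝ) ^ ST < q * j + j := by exact_mod_cast Nat.lt_div_mul_add hj0
  have hjr : (0 : ℝ) < j := by exact_mod_cast hj0
  have hA : (q : ℝ) ≤ 2 ^ ST / j := by rw [le_div_iff₀ hjr]; exact hq1
  have hB : (2 : ℝ) ^ ST / j ≤ q + 1 := by rw [div_le_iff₀ hjr]; linarith
  have e : (((liouville j : ℤ) * (q : ℤ) : ℤ) : ℝ) - 2 ^ ST * ((liouville j : ℝ) / j) =
      (liouville j : ℝ) * ((q : ℝ) - 2 ^ ST / j) := by
    push_cast; ring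
  rw [e, abs_mul]
  refine mul_le_one₀ (LiouvilleSum.abs_liouville_le_one j) (abs_nonneg _) ?_
  rw [abs_sub_le_iff]; constructor <;> linarith

/-- Size of `tPre`. [folklore] -/
theorem size_tPre (lam : Array Bool) (W : ℕ) : (tPre lam W).size = W + 1 := size_prefixSums _ _

/-- The entries of `tPre` are `τ(k)`, `k ≤ W` (when the bit table is `λ`). [folklore] -/
theorem tPre_getElem? {W : ℕ} (hWP : W + Q ≤ P ^ 2) {k : ℕ} (hk : k ≤ W) :
    (tPre (lamBits (pattern Q) W) W)[k]? = some (tau k) := by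
  rw [tPre, prefixSums_getElem? _ _ hk, tau]
  congr 1
  refine sum_congr rfl fun j hj => ?_
  rw [lamOfBit_lamBits hWP (mem_Ioc.1 hj).1 ((mem_Ioc.1 hj).2.trans hk)]

/-- Size of `tSeg`. [folklore] -/
theorem size_tSeg (e : Array ℤ) (lo : ℕ) : (tSeg e lo).size = e.size + 1 := size_prefixSums _ _

/-- Reindexing `j ↦ lo + j - 1` from `Ioc 0 i` onto `Ioc (lo - 1) (lo + i - 1)` (`1 ≤ lo`). [folklore] -/
theorem sum_Ioc_shift {β : Type} [AddCommMonoid β] (f : ℕ → β) {lo : ℕ} (hlo : 1 ≤ lo) (i : ℕ) :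
    ∑ x ∈ Ioc (lo - 1) (lo + i - 1), f x = ∑ j ∈ Ioc 0 i, f (lo + j - 1) := by
  induction i with
  | zero => simp
  | succ n ih =>
    rw [sum_Ioc_succ_top (Nat.zero_le n), ← ih,
      show lo + (n + 1) - 1 = (lo + n - 1) + 1 by omega, sum_Ioc_succ_top (by omega)]

/-- The entries of `tSeg` on a correctly sieved segment `[lo, lo+Q)` (`Q ∣ lo`, `lo + Q ≤ P²`,
`1 ≤ lo`): `t[i] = τ(lo + i − 1) − τ(lo − 1)` for `i ≤ Q`. [folklore] -/
theorem tSeg_getElem? {lo : ℕ} (hlo : Q ∣ lo) (hH : lo + Q ≤ P ^ 2) (hlo1 : 1 ≤ lo) {i : ℕ}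
    (hi : i ≤ Q) :
    (tSeg (segSieve primesList lo (pattern Q)) lo)[i]? = some (tau (lo + i - 1) - tau (lo - 1)) := by
  have hsz0 : (segSieve primesList lo (pattern Q)).size = Q := size_segSieve_pattern lo
  unfold tSeg
  rw [prefixSums_getElem? _ _ (by rw [hsz0]; exact hi), tau_sub_tau (by omega),
    sum_Ioc_shift _ hlo1]
  congr 1
  refine sum_congr rfl fun j hj => ?_
  obtain ⟨hj1, hj2⟩ := mem_Ioc.1 hj
  have hjQ : j - 1 < Q := by omega
  have hsz : j - 1 < (segSieve primesList lo (pattern Q)).size := by rw [hsz0]; exact hjQ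
  rw [getElem!_pos (segSieve primesList lo (pattern Q)) (j - 1) hsz]
  have hkey := lamOf_segSieve lo hlo hH (j - 1) hjQ (by omega) (Array.getElem?_eq_getElem hsz)
  rw [show lo + (j - 1) = lo + j - 1 by omega] at hkey
  rw [hkey]

end Literature.Barriers.RiemannHypothesis.TuranMinWitness
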